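/-
Copyright (c) 2026 the pub-hodgecm-mathlib formalisation cell (harness21).  Prover seat hodgecm-mathlib-LH4-p11 (g8), Track A «(D-RAM) FOUR-FRAME» squad, helper lane on
h413 = stmt-HodgeConjecture-24833 (count-neutral).  Heir dealer∕pen LH4-plan (g13) WORD #70 (2) ∕ WORD #82 (B) «B2a-3 = LH4-p11»; SPEC-B2 v1 3227ed60, SIG (B2a-2) v1 dbcde430.
2026-09-04.
-/
import Summits.HodgeConjecture.HodgeConjecture.Theorems.F0P3cDyRamDiagonalOrbitReindexPairLabel   -- ★ p860198 (this seat, (B2a-1)): `cast_sum_mul_ncard_fixed_vertices_sepAt_eq_finsum`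
import Summits.HodgeConjecture.HodgeConjecture.Theorems.F0P3cDyRamDiagonalKappaOrbitCount        -- ★ p856579 (LH4-p05 (g3)): the SIGNED engine `finsum_mem_eq_eight_mul_finsum_mul_stabiliserWeight`; brings ★ (O2b) PARTS 1–4,
                                                                                                 -- `…OrbitFibreTransport` (`existsUnique_signVector_mem_map_unitNormMap`, `map_unitNormMap_unitTorus_le`), `…TorusRepresentativesCount`, `…OrbitAveraging`
import Summits.HodgeConjecture.HodgeConjecture.Theorems.F0P3cDyRamDiagonalOrbitCountLabelled      -- ★ p858820 (LH4-p09 (g8)): `finsum_mem_sep_eq_finsum_mem_ite`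
import Summits.HodgeConjecture.HodgeConjecture.Theorems.F0P3cDyRamDiagonalOrbitFibreCountMult     -- ★ (O2b)-MULT (LH4-p14): `relIndex_map_unitNormMap_unitTorus_eq_eight` (`[𝒰 : N𝒯] = 8`)
import HarnessLib

/-!
# Crux `H413`, line LH4 «(D-RAM) FOUR-FRAME» — (B2a-3) «THE LABELLED STAGE-A ENGINE»: the signed eight-class sum of label-cut fixed-vertex counts (an invariant level label `Q`
# AND a class-dependent label `P e` read at the vertex) equals `8 · Σᶠ_{M₀ ∈ 𝓛₀(T), Q M₀} L(M₀) ∕ [𝒰 : N(S̃(M₀) ∩ 𝒯)]` MODULO the per-orbit fibre identity of SIG (B2a-2)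

Cell `hodgecm-mathlib` (D-0151), FLOOR 0, crux item H413 = `stmt-HodgeConjecture-24833`, route `HCCMUnconditional`; squad F0∕P3c∕LH4.  THEOREMS ONLY (no `def`, no instance,
no notation, no `sorry`, default heartbeats); ★-only imports; lane `--supports stmt-HodgeConjecture-24833 --as helper` (count-neutral); pays NO row, states NO law (the
per-orbit identity is a HYPOTHESIS here — LH4-p10 (g6)'s (B2a-2) against the DEFS leaf «LabelledOddCountDefs»; this file does not import the leaf: `L` and `P` are generic).

THE MATHEMATICS (SPEC-B2 v1 §2 (B2a-3); ★ (Oκ2c) `cast_sum_signChar_mul_ncard_sep_eq_eight_mul_finsum_kappaCount` is the shape).  Data: `T = diag(s)` regular unit diagonal over a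
finite residue field, `σ` an isometric involution, uniformiser `ϖ = ↑ϖu`, a `σ`-fixed NON-NORM unit `c` with the index-two dichotomy (only used for `[𝒰 : N𝒯] = 8`), a type
`tv`, ANY weight `χ : (Fin 3 → Bool) → ℤ`, a torus-INVARIANT label `Q` (the level tokens) and ANY family `P e` of labels read at the vertex (the class-`e` value label).  IF at
every `M₀ ∈ 𝓛₀(T)` with `Q M₀` the per-orbit identity
  `(Σ_e χ(e) · Σᶠ_{M ∈ 𝒯·M₀} #{a : diag(ϖu^{a})·M type tv for diag(d_e) ∧ P e (diag(ϖu^{a})·M)}) · [𝒰 : N(S̃'(M₀))] = 8 · [𝒯 : S̃'(M₀)] · L(M₀)`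
holds (`S̃' = unitStabilizer`, `N = unitNormMap`; for `χ = (−1)^{e_i}` and `P e =` the class label this is SIG (B2a-2) with `L = labelledOddCount`), THEN
  `↑(Σ_e χ(e) · #{M : type tv for diag(d_e), T·M = M, Q M ∧ P e M}) = 8 · Σᶠ_{M₀ ∈ 𝓛₀(T), Q M₀} L(M₀) ∕ [𝒰 : N(S̃'(M₀))]`   (over `ℚ`).
Proof: ★ (B2a-1) re-indexes; the ★ signed engine is fed with `F(M) := Σ_e χ(e)·#{a : … ∧ Q(⋯) ∧ P e (⋯)}` and `m(M₀) := [Q M₀]·L(M₀)·[𝒰 : S_F(M₀)]∕[𝒰 : N S̃'(M₀)]`; on a `Q`-orbit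
the `Q`-conjunct is identically true (invariance, twice), the finite orbit sum and the class sum commute, and the hypothesis divided by `[𝒰 : N S̃'] ≠ 0` (§1) is the engine's
per-orbit input; off the `Q`-orbits both sides vanish; finally `m·stabiliserWeight = [Q]·L∕[𝒰 : N S̃']` (`[𝒰 : S_F] ≠ 0`, ★ `relIndex_fixedUnitStabilizer_ne_zero_of_finite`).
* §1 `ker_unitNormMap_le_unitTorus`, **`relIndex_map_unitNormMap_unitStabilizer_ne_zero`** (`[𝒰 : N(S̃'(M₀))] ≠ 0` on a finite orbit: tower over `N𝒯` — ★ (O2b)-MULT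
  `relIndex_map_unitNormMap_unitTorus_eq_eight` `[𝒰 : N𝒯] = 8` — and `[N𝒯 : N S̃'] ∣ [𝒯 : S̃']` by `Subgroup.relIndex_map_map`).
* §2 HEAD `cast_sum_mul_ncard_sepAt_eq_eight_mul_finsum_div_of_fibre_identity`.
HONEST LABEL.  Count-neutral orbit bookkeeping; proves no census: the eightfold vanishing, (β-BAL), (A″), (β), T₊ OPEN; `HC_CM` is proved only modulo the 7 printed citations
(2 remaining named inputs: hLiu418 = `stmt-HodgeConjecture-24832`, h413 = `stmt-HodgeConjecture-24833`) until rung 0 closes.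

## References
* [Kottwitz1986BaseChangeUnits] R. E. Kottwitz, *Base change for unit elements of Hecke algebras*, Compositio Math. 60 (1986), §1 pp. 240–241 (κ-orbital integrals of units
  as signed lattice counts modulo the diagonal torus, weighted by stabiliser indices).
* [Rogawski1990] J. D. Rogawski, *Automorphic Representations of Unitary Groups in Three Variables*, Ann. of Math. Stud. 123 (1990), §4.9 Prop. 4.9.1 (a)(b) p. 55, §4.10 p. 58.
* [LanglandsShelstad1987] R. P. Langlands, D. Shelstad, *On the definition of transfer factors*, Math. Ann. 278 (1987), §1.3, §3.
* [Serre1979] J.-P. Serre, *Local Fields*, GTM 67 (1979), Ch. V §3 Cor. 3 (`[U_F : N U_E] = 2` per slot).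
-/

set_option autoImplicit false

noncomputable section

namespace Summit.HodgeConjecture.HodgeConjecture.Cruxes.H413.F0P3cDyRamDiagonalLabelledOddOrbitCount

open Literature.NumberTheory.Automorphic Literature.NumberTheory.Automorphic.HermitianLattice
open Literature.NumberTheory.Automorphic.UnitaryLatticeTree Literature.NumberTheory.Automorphic.UnitaryThreeFourFrame
open Summit.HodgeConjecture.HodgeConjecture.Cruxes.H413.F0P3cDyRamDiagonalTorusDefs
open Summit.HodgeConjecture.HodgeConjecture.Cruxes.H413.F0P3cDyRamDiagonalStableLatticesFinite
open Summit.HodgeConjecture.HodgeConjecture.Cruxes.H413.F0P3cDyRamDiagonalOrbitAveraging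
open Summit.HodgeConjecture.HodgeConjecture.Cruxes.H413.F0P3cDyRamDiagonalOrbitFibreTransport
open Summit.HodgeConjecture.HodgeConjecture.Cruxes.H413.F0P3cDyRamDiagonalOrbitFibreCountHeads
open Summit.HodgeConjecture.HodgeConjecture.Cruxes.H413.F0P3cDyRamTorusRepresentativesCount
open Summit.HodgeConjecture.HodgeConjecture.Cruxes.H413.F0P3cDyRamDiagonalKappaOrbitCount
open Summit.HodgeConjecture.HodgeConjecture.Cruxes.H413.F0P3cDyRamDiagonalOrbitReindexPairLabel
open Summit.HodgeConjecture.HodgeConjecture.Cruxes.H413.F0P3cDyRamDiagonalOrbitCountLabelled (finsum_mem_sep_eq_finsum_mem_ite)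
open Summit.HodgeConjecture.HodgeConjecture.Cruxes.H413.F0P3cDyRamDiagonalOrbitFibreCountMult (relIndex_map_unitNormMap_unitTorus_eq_eight)
open scoped Valued WithZero Matrix MatrixGroups

variable {K : Type} [Field K] [Valued K ℤᵐ⁰]

/-! ## §1  The index `[𝒰 : N(S̃'(M₀))]` is non-zero on a finite orbit -/

/-- The kernel of the norm map consists of units (`|z_i|·|σz_i| = 1`, `σ` isometric ⇒ `|z_i| = 1`). [cite: Serre1979, Ch. V §3] -/
theorem ker_unitNormMap_le_unitTorus {σ : K →+* K} (hvσ : ∀ a, Valued.v (σ a) = Valued.v a) : (unitNormMap σ 3).ker ≤ unitTorus K 3 := by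
  intro z hz
  rw [mem_unitTorus_iff]
  intro i
  have h := congrArg (fun f : Fin 3 → Kˣ => ((f i : Kˣ) : K)) (MonoidHom.mem_ker.1 hz)
  simp only [unitNormMap_apply, Pi.one_apply, Units.val_one] at h
  have h2 : Valued.v ((z i : Kˣ) : K) * Valued.v ((z i : Kˣ) : K) = 1 := by
    nth_rw 2 [← hvσ]
    rw [← map_mul, h, map_one]
  rw [← pow_two] at h2
  exact ((pow_eq_one_iff).1 h2).resolve_right two_ne_zero

/-- **`[𝒰 : N(S̃'(M₀))] ≠ 0` ON A FINITE UNIT-TORUS ORBIT** (`S̃' = unitStabilizer M₀`): by the tower over `N𝒯` — `[𝒰 : N𝒯] = 8` (§1) and `[N𝒯 : N S̃'] = [𝒯 : S̃' ⊔ ker N]`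
(`Subgroup.relIndex_map_map`, `ker N ≤ 𝒯`) divides `[𝒯 : S̃'] ≠ 0` (★ `relIndex_unitStabilizer_ne_zero_of_finite`).  The denominator of the labelled Stage-A weight.
[cite: Kottwitz1986BaseChangeUnits, §1 pp. 240–241] [cite: Serre1979, Ch. V §3 Cor. 3] -/
theorem relIndex_map_unitNormMap_unitStabilizer_ne_zero {σ : K →+* K} (hσ : ∀ x, σ (σ x) = x) (hvσ : ∀ a, Valued.v (σ a) = Valued.v a)
    {c : K} (hσc : σ c = c) (hcv : Valued.v c = 1) (hc : ¬ ∃ z : K, z * σ z = c)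
    (hdich : ∀ x : K, σ x = x → x ≠ 0 → (∃ z : K, z * σ z = x) ∨ ∃ z : K, z * σ z = c * x)
    {M₀ : Submodule 𝒪[K] (Fin 3 → K)} (hfin : {M : Submodule 𝒪[K] (Fin 3 → K) | ∃ u ∈ unitTorus K 3, M = mapGL (diagGLUnits u) M₀}.Finite) :
    ((unitStabilizer M₀).map (unitNormMap σ 3)).relIndex (fixedUnitTorus σ 3) ≠ 0 := by
  have hNT : (unitTorus K 3).map (unitNormMap σ 3) ≤ fixedUnitTorus σ 3 := map_unitNormMap_unitTorus_le hσ hvσ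
  have hST : unitStabilizer M₀ ≤ unitTorus K 3 := inf_le_right
  have hSN : (unitStabilizer M₀).map (unitNormMap σ 3) ≤ (unitTorus K 3).map (unitNormMap σ 3) := Subgroup.map_mono hST
  rw [← Subgroup.relIndex_mul_relIndex _ _ _ hSN hNT, relIndex_map_unitNormMap_unitTorus_eq_eight hσ hvσ hσc hcv hc hdich]
  refine mul_ne_zero ?_ (by norm_num)
  -- `[N𝒯 : N S̃'] = [𝒯 ⊔ ker : S̃' ⊔ ker] = [𝒯 : S̃' ⊔ ker]` divides `[𝒯 : S̃']`
  rw [Subgroup.relIndex_map_map, sup_eq_left.2 (ker_unitNormMap_le_unitTorus hvσ)]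
  intro h0
  apply relIndex_unitStabilizer_ne_zero_of_finite hfin
  exact Nat.eq_zero_of_zero_dvd (h0 ▸ Subgroup.relIndex_dvd_of_le_left (unitTorus K 3) (le_sup_left : unitStabilizer M₀ ≤ unitStabilizer M₀ ⊔ (unitNormMap σ 3).ker))

/-! ## §2  HEAD: the labelled signed eight-class sum, modulo the per-orbit fibre identity -/

/-- **THE LABELLED STAGE-A ENGINE (modulo SIG (B2a-2)).**  Finite residue field, `σ` an isometric involution, uniformiser `ϖ = ↑ϖu`, a `σ`-fixed NON-NORM unit `c` with the
index-two dichotomy, a regular unit diagonal `T = diag(s)`, a type `tv`, ANY weight `χ`, a torus-INVARIANT label `Q`, ANY family `P e` of labels read at the vertex, and ANY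
`L : lattices → ℤ`.  IF at every `M₀ ∈ 𝓛₀(T)` with `Q M₀`:
`(Σ_e χ(e) · Σᶠ_{M ∈ 𝒯·M₀} #{a : diag(ϖu^{a})·M type tv for diag(d_e) ∧ P e (diag(ϖu^{a})·M)}) · [𝒰 : N(S̃'(M₀))] = 8 · [𝒯 : S̃'(M₀)] · L(M₀)`,
THEN `↑(Σ_e χ(e) · #{M : type tv for diag(d_e), T·M = M, Q M ∧ P e M}) = 8 · Σᶠ_{M₀ ∈ 𝓛₀(T), Q M₀} L(M₀) ∕ [𝒰 : N(S̃'(M₀))]` (`d_e j = c` if `e j` else `1`).  With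
`χ(e) = (−1)^{e_i}`, `Q` = the clean-shell level tokens, `P e` = the class label of `d_e` and `L = labelledOddCount` this is (A_L) of SPEC-B2; with `χ = χ⁰_i`, `P ≡ True` and the
★ (Oκ2b) identity (rescaled) it is ★ (Oκ2c). [cite: Kottwitz1986BaseChangeUnits, §1 pp. 240–241] [cite: Rogawski1990, §4.9 Prop. 4.9.1 (a)(b) p. 55, §4.10 p. 58] [cite: LanglandsShelstad1987, §3] -/
theorem cast_sum_mul_ncard_sepAt_eq_eight_mul_finsum_div_of_fibre_identity [Finite 𝓀[K]] {σ : K →+* K} (hσ : ∀ x, σ (σ x) = x)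
    (hvσ : ∀ a, Valued.v (σ a) = Valued.v a) {ϖ : K} (hϖ : Valued.v ϖ = WithZero.exp (-1 : ℤ)) (ϖu : Kˣ) (hϖu : (ϖu : K) = ϖ)
    {c : K} (hσc : σ c = c) (hcv : Valued.v c = 1) (hc : ¬ ∃ z : K, z * σ z = c)
    (hdich : ∀ x : K, σ x = x → x ≠ 0 → (∃ z : K, z * σ z = x) ∨ ∃ z : K, z * σ z = c * x)
    {s : Fin 3 → K} (hs : ∀ i, Valued.v (s i) = 1) (hreg : ∀ i j, i ≠ j → s i ≠ s j)
    (T : GL (Fin 3) K) (hT : (T : Matrix (Fin 3) (Fin 3) K) = Matrix.diagonal s) (tv : ℕ)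
    (χ : (Fin 3 → Bool) → ℤ) (Q : Submodule 𝒪[K] (Fin 3 → K) → Prop)
    (hQ : ∀ (z : Fin 3 → Kˣ) (M : Submodule 𝒪[K] (Fin 3 → K)), Q (mapGL (diagGLUnits z) M) ↔ Q M)
    (P : (Fin 3 → Bool) → Submodule 𝒪[K] (Fin 3 → K) → Prop) (L : Submodule 𝒪[K] (Fin 3 → K) → ℤ)
    (hfib : ∀ M₀ ∈ normalisedStableLattices T, Q M₀ →
      (∑ e : Fin 3 → Bool, (χ e : ℚ) *
          ((∑ᶠ M ∈ {M : Submodule 𝒪[K] (Fin 3 → K) | ∃ u ∈ unitTorus K 3, M = mapGL (diagGLUnits u) M₀},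
            ({a : Fin 3 → ℤ | IsVertexLattice σ ϖ (Matrix.diagonal fun j => if e j then c else (1 : K)) tv (mapGL (diagGLUnits fun j => ϖu ^ a j) M) ∧
              P e (mapGL (diagGLUnits fun j => ϖu ^ a j) M)} : Set _).ncard : ℕ) : ℚ)) *
        ((((unitStabilizer M₀).map (unitNormMap σ 3)).relIndex (fixedUnitTorus σ 3) : ℕ) : ℚ) =
      8 * (((unitStabilizer M₀).relIndex (unitTorus K 3) : ℕ) : ℚ) * (L M₀ : ℚ)) :
    (((∑ e : Fin 3 → Bool, χ e *
        ({M : Submodule 𝒪[K] (Fin 3 → K) |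
          IsVertexLattice σ ϖ (Matrix.diagonal fun j => if e j then c else (1 : K)) tv M ∧ mapGL T M = M ∧ (Q M ∧ P e M)}.ncard : ℤ) : ℤ) : ℚ)) =
      8 * ∑ᶠ M₀ ∈ {M | M ∈ normalisedStableLattices T ∧ Q M},
        (L M₀ : ℚ) / ((((unitStabilizer M₀).map (unitNormMap σ 3)).relIndex (fixedUnitTorus σ 3) : ℕ) : ℚ) := by
  classical
  have h𝓛 : (normalisedStableLattices T).Finite := finite_setOf_normalised_diagonal_fixed_latt hϖ s hs hreg T hT
  rw [cast_sum_mul_ncard_fixed_vertices_sepAt_eq_finsum hvσ hϖ ϖu hϖu hcv hs hreg T hT tv χ (fun e M => Q M ∧ P e M)]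
  -- the engine, fed with the labelled signed fibre count and the multiplicity `[Q]·L·[𝒰 : S_F]∕[𝒰 : N S̃']`
  have key := finsum_mem_eq_eight_mul_finsum_mul_stabiliserWeight hϖ hs hreg T hT σ
    (fun M => ∑ e : Fin 3 → Bool, (χ e : ℚ) *
      ((({a : Fin 3 → ℤ | IsVertexLattice σ ϖ (Matrix.diagonal fun j => if e j then c else (1 : K)) tv (mapGL (diagGLUnits fun j => ϖu ^ a j) M) ∧
          (Q (mapGL (diagGLUnits fun j => ϖu ^ a j) M) ∧ P e (mapGL (diagGLUnits fun j => ϖu ^ a j) M))} : Set _).ncard : ℕ) : ℚ))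
    (fun M₀ => if Q M₀ then (L M₀ : ℚ) * (((fixedUnitStabilizer σ M₀).relIndex (fixedUnitTorus σ 3) : ℕ) : ℚ) /
        ((((unitStabilizer M₀).map (unitNormMap σ 3)).relIndex (fixedUnitTorus σ 3) : ℕ) : ℚ) else 0) fun M₀ hM₀ => ?_
  · rw [key, finsum_mem_sep_eq_finsum_mem_ite h𝓛 Q]
    congr 1
    refine finsum_mem_congr rfl fun M₀ hM₀ => ?_
    have hfinO := finite_unitTorus_orbit_of_mem_normalisedStableLattices hϖ hs hreg T hT hM₀
    have hSF : (((fixedUnitStabilizer σ M₀).relIndex (fixedUnitTorus σ 3) : ℕ) : ℚ) ≠ 0 :=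
      Nat.cast_ne_zero.2 (relIndex_fixedUnitStabilizer_ne_zero_of_finite σ hfinO)
    split_ifs
    · rw [stabiliserWeight]
      field_simp
    · simp
  -- the per-orbit hypothesis
  · have hfinO := finite_unitTorus_orbit_of_mem_normalisedStableLattices hϖ hs hreg T hT hM₀
    have hNS : ((((unitStabilizer M₀).map (unitNormMap σ 3)).relIndex (fixedUnitTorus σ 3) : ℕ) : ℚ) ≠ 0 :=
      Nat.cast_ne_zero.2 (relIndex_map_unitNormMap_unitStabilizer_ne_zero hσ hvσ hσc hcv hc hdich hfinO)
    by_cases hQ₀ : Q M₀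
    · rw [if_pos hQ₀]
      -- on a `Q`-orbit the `Q`-conjunct is identically true
      have hF : ∀ M ∈ {M : Submodule 𝒪[K] (Fin 3 → K) | ∃ u ∈ unitTorus K 3, M = mapGL (diagGLUnits u) M₀},
          (∑ e : Fin 3 → Bool, (χ e : ℚ) *
            ((({a : Fin 3 → ℤ | IsVertexLattice σ ϖ (Matrix.diagonal fun j => if e j then c else (1 : K)) tv (mapGL (diagGLUnits fun j => ϖu ^ a j) M) ∧
                (Q (mapGL (diagGLUnits fun j => ϖu ^ a j) M) ∧ P e (mapGL (diagGLUnits fun j => ϖu ^ a j) M))} : Set _).ncard : ℕ) : ℚ)) =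
          ∑ e : Fin 3 → Bool, (χ e : ℚ) *
            ((({a : Fin 3 → ℤ | IsVertexLattice σ ϖ (Matrix.diagonal fun j => if e j then c else (1 : K)) tv (mapGL (diagGLUnits fun j => ϖu ^ a j) M) ∧
                P e (mapGL (diagGLUnits fun j => ϖu ^ a j) M)} : Set _).ncard : ℕ) : ℚ) := by
        rintro M ⟨u, -, rfl⟩
        refine Finset.sum_congr rfl fun e _ => ?_
        have hQM : ∀ a : Fin 3 → ℤ, Q (mapGL (diagGLUnits fun j => ϖu ^ a j) (mapGL (diagGLUnits u) M₀)) := fun a =>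
          (hQ _ _).2 ((hQ u M₀).2 hQ₀)
        congr 3
        ext a
        simp only [Set.mem_setOf_eq, hQM a, true_and]
      rw [finsum_mem_congr rfl hF]
      -- swap the orbit sum with the class sum
      have hswap : (∑ᶠ M ∈ {M : Submodule 𝒪[K] (Fin 3 → K) | ∃ u ∈ unitTorus K 3, M = mapGL (diagGLUnits u) M₀},
          ∑ e : Fin 3 → Bool, (χ e : ℚ) *
            ((({a : Fin 3 → ℤ | IsVertexLattice σ ϖ (Matrix.diagonal fun j => if e j then c else (1 : K)) tv (mapGL (diagGLUnits fun j => ϖu ^ a j) M) ∧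
                P e (mapGL (diagGLUnits fun j => ϖu ^ a j) M)} : Set _).ncard : ℕ) : ℚ)) =
          ∑ e : Fin 3 → Bool, (χ e : ℚ) *
            ((∑ᶠ M ∈ {M : Submodule 𝒪[K] (Fin 3 → K) | ∃ u ∈ unitTorus K 3, M = mapGL (diagGLUnits u) M₀},
              ({a : Fin 3 → ℤ | IsVertexLattice σ ϖ (Matrix.diagonal fun j => if e j then c else (1 : K)) tv (mapGL (diagGLUnits fun j => ϖu ^ a j) M) ∧
                P e (mapGL (diagGLUnits fun j => ϖu ^ a j) M)} : Set _).ncard : ℕ) : ℚ) := by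
        rw [finsum_mem_eq_finite_toFinset_sum _ hfinO, Finset.sum_comm]
        refine Finset.sum_congr rfl fun e _ => ?_
        rw [finsum_mem_eq_finite_toFinset_sum _ hfinO, Nat.cast_sum, Finset.mul_sum]
      rw [hswap]
      -- the hypothesis, divided by `[𝒰 : N S̃'] ≠ 0`, times `[𝒰 : S_F]`
      have h := hfib M₀ hM₀ hQ₀
      have h' : (∑ e : Fin 3 → Bool, (χ e : ℚ) *
            ((∑ᶠ M ∈ {M : Submodule 𝒪[K] (Fin 3 → K) | ∃ u ∈ unitTorus K 3, M = mapGL (diagGLUnits u) M₀},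
              ({a : Fin 3 → ℤ | IsVertexLattice σ ϖ (Matrix.diagonal fun j => if e j then c else (1 : K)) tv (mapGL (diagGLUnits fun j => ϖu ^ a j) M) ∧
                P e (mapGL (diagGLUnits fun j => ϖu ^ a j) M)} : Set _).ncard : ℕ) : ℚ)) =
          8 * (((unitStabilizer M₀).relIndex (unitTorus K 3) : ℕ) : ℚ) * (L M₀ : ℚ) /
            ((((unitStabilizer M₀).map (unitNormMap σ 3)).relIndex (fixedUnitTorus σ 3) : ℕ) : ℚ) := by
        rw [eq_div_iff hNS]
        exact h
      rw [h']
      field_simp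
    · rw [if_neg hQ₀, mul_zero]
      have hzero : ∀ M ∈ {M : Submodule 𝒪[K] (Fin 3 → K) | ∃ u ∈ unitTorus K 3, M = mapGL (diagGLUnits u) M₀},
          (∑ e : Fin 3 → Bool, (χ e : ℚ) *
            ((({a : Fin 3 → ℤ | IsVertexLattice σ ϖ (Matrix.diagonal fun j => if e j then c else (1 : K)) tv (mapGL (diagGLUnits fun j => ϖu ^ a j) M) ∧
                (Q (mapGL (diagGLUnits fun j => ϖu ^ a j) M) ∧ P e (mapGL (diagGLUnits fun j => ϖu ^ a j) M))} : Set _).ncard : ℕ) : ℚ)) = 0 := by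
        rintro M ⟨u, -, rfl⟩
        refine Finset.sum_eq_zero fun e _ => ?_
        have hQM : ∀ a : Fin 3 → ℤ, ¬ Q (mapGL (diagGLUnits fun j => ϖu ^ a j) (mapGL (diagGLUnits u) M₀)) := fun a h =>
          hQ₀ ((hQ u M₀).1 ((hQ _ _).1 h))
        have hempty : ({a : Fin 3 → ℤ | IsVertexLattice σ ϖ (Matrix.diagonal fun j => if e j then c else (1 : K)) tv
              (mapGL (diagGLUnits fun j => ϖu ^ a j) (mapGL (diagGLUnits u) M₀)) ∧
            (Q (mapGL (diagGLUnits fun j => ϖu ^ a j) (mapGL (diagGLUnits u) M₀)) ∧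
              P e (mapGL (diagGLUnits fun j => ϖu ^ a j) (mapGL (diagGLUnits u) M₀)))} : Set _) = ∅ :=
          Set.eq_empty_of_forall_notMem fun a ha => hQM a ha.2.1
        rw [hempty, Set.ncard_empty, Nat.cast_zero, mul_zero]
      rw [finsum_mem_congr rfl hzero]
      simp only [finsum_zero, zero_mul]

end Summit.HodgeConjecture.HodgeConjecture.Cruxes.H413.F0P3cDyRamDiagonalLabelledOddOrbitCount

end
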